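/- Copyright: the b2b-balaban cell (near-miss cell 7), T⁴-continuum fan-out; row NE7b CRUX team (2), seat
t4-ne7b-formalise-leaf-02 (gen 27) — E-side of the OWNER's INTERFACE REQUEST NE7b IR-44-1 (HOME/INBOX.md l.7662, `CLAIMS.log` l.30796 ∕
claim l.30887): the apex input and the HEADLINE over the weighted witness `CountRoadWitnessT3bWTVS`.  Released under the licence of the
surrounding project. -/
import Summits.QuantumFields.BalabanUV.T4Continuum.Support.HistoryRealiseCellsRunApexT3bWTVS

/-!
# Realised histories: ROW NE7b AT THE APEX AND THE HEADLINE FROM THE WEIGHTED `κ := costT` WITNESS, SPLIT SLACK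
`C.a + (θ + θᵥ) ≤ ½γ₀A₁²` (IR-44-1, E-side, witness level)

Summits-side support leaf of the T⁴-continuum cell (rung (B)+1 on a FINITE torus only; NOT infinite volume, NOT the mass
gap, NOT the Clay statement; NOT a proof of the spine estimate NE7b, which is the cell's OWN estimate, NOT PRINTED and NOT
PROVED).  [folklore] composition by name: the owner's `HistoryRealiseCellsRunApexT3bWTV.hybridNE7Under_of_countRoadT3bWTV_fsc` ∕
`continuumYM4Torus_of_countRoadT3bWTV_fsc` (p263890) AT THE RE-SLACKED RECORD `reslack O θᵥ`, fed by the sibling's embedding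
`CountRoadWitnessT3bWTVS.toWTV` and the slack identity `reslack_hslack`; no definition, no `[cite:]` tag, nothing printed asserted,
zero `sorry`.  Append-only: the owner's V-headline, E7T and the headline of record p224237 stay, UNCHANGED BY NAME.

WHAT.  **`hybridNE7Under_of_countRoadT3bWTVS_fsc`**, **`continuumYM4Torus_of_countRoadT3bWTVS_fsc`**: the owner's two statements
with EXACTLY two edits — the prefixed witness is `CountRoadWitnessT3bWTVS D C O θᵥ …` (price sentences at `κ := costT` carrying
`Real.exp (birthWT Prod.fst (uV K) q.2)`, display `huV` = D-V1), and the slack hypothesis is `hslack : C.a + (θ + θv) ≤ O.γ₀ * O.A₁ ^ 2 / 2`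
(`θ` the slot multiplicity's, `hθJ` unchanged; `θᵥ` free — no sign hypothesis is needed); conclusions VERBATIM
(`T4ApexHybrid.HybridNE7Under D (BetaPertHyp D.βfun)` ∕ `T4ContinuumYM4Torus.ContinuumYM4Torus D`).  Two closing `example`s: the
owner's V-witness is the weighted witness at `uV := 0` (so the V-headline is the special case `θᵥ := 0` of this one, by name).

BY-NAME EFFECT ON THE WALL (`WALL-NE7b-P1.md` §2, for the owner to record): in the weighted witness the price sentences
`priceM`∕`priceM′` are stated at the model's booked cost WITH the volume's class remainder as a DISPLAYED weight family under D-V1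
— their volume part and class remainder are no longer READ; what they still read is the CREDIT part (located question Q-44-1:
`evProd (fB K) (fR K)` against `e^{−pcredits}·e^{−Ξ}`) and the dead part `resumM`.  DISPLAYED, NOT DISCHARGED (unchanged list
otherwise): H3^NE7b's `realised` reading and numerator readings, (B) `B16.EndStatementBPrinted`, `BetaPertHyp`, the flow box
bounds ∕ tuning ∕ IR smallness (`ForSmallCouplings`), NE7c's `ShellWeightBound`, NE7's `ReindexedBudget` + four summable rates,
END v3′'s constants-only side conditions.  HONEST: NE7b NOT proved; spine 0∕9; rung (B)+1 finite T⁴ — NOT infinite volume,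
NOT mass gap, NOT Clay.  HONEST DEPENDENCY (cell): continuum YM on T⁴ ⇐ BetaPertH ∧ nine spine estimates (0/9 proved);
BetaPertH ⇐ (D1) ∧ (D4) ∧ CAP+tail; G-an2-4 gates asym, D1 and NE2/3/4.  This file changes none of it. -/

open Finset MeasureTheory
open Literature.MathematicalPhysics.QuantumFieldTheory.Balaban1983to89
open T4PersistenceDictionary T4PersistentHistoryCount T4BankedInduction T4PrintedShapeBanking
open T4WeightBudget T4GlobalDenominator T4LiveClassFibration T4LiveStructureGas T4LiveGasToTerms T4RecordPriceSeam
open T4PartnerMultiplicity T4IndicatorShell T4MatchingAssembly T4MatchingClosure T4MatchingClosureSocket T4Continuum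
open T4StabilitySocket T4BranchingRecordsGas T4TaggedShapeBanking T4CanonicalMenus T4RenewalChains
open Summit.QuantumFields.BalabanUV.T4Continuum.PlacementBatch Summit.QuantumFields.BalabanUV.T4Continuum.PlacementSkeleton
open Summit.QuantumFields.BalabanUV.T4Continuum.CountThresholdUniform Summit.QuantumFields.BalabanUV.T4Continuum.CountThresholdExit
open Summit.QuantumFields.BalabanUV.T4Continuum.CountSeamJunction Summit.QuantumFields.BalabanUV.T4Continuum.LateMergers
open Summit.QuantumFields.BalabanUV.T4Continuum.HistoryFlow Summit.QuantumFields.BalabanUV.T4Continuum.HistoryRegeneration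
open Summit.QuantumFields.BalabanUV.T4Continuum.HistoryTables Summit.QuantumFields.BalabanUV.T4Continuum.HistoryAssemblyTrees
open Summit.QuantumFields.BalabanUV.T4Continuum.HistoryAssemblyTerms Summit.QuantumFields.BalabanUV.T4Continuum.HistoryAssemblyPedigree
open Summit.QuantumFields.BalabanUV.T4Continuum.HistoryConstants Summit.QuantumFields.BalabanUV.T4Continuum.HistoryGen
open Literature.MathematicalPhysics.QuantumFieldTheory.Balaban1983to89.B13ScaleTransfer
open Summit.QuantumFields.BalabanUV.T4Continuum.ZoneSkeleton Summit.QuantumFields.BalabanUV.T4Continuum.HistorySocketTH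
open Summit.QuantumFields.BalabanUV.T4Continuum.HistoryCaps Summit.QuantumFields.BalabanUV.T4Continuum.HistoryAssemblyPrice
open Summit.QuantumFields.BalabanUV.T4Continuum.HistoryBankingLE Summit.QuantumFields.BalabanUV.T4Continuum.HistoryExitLE
open Summit.QuantumFields.BalabanUV.T4Continuum.HistoryAssemblyTreesLE Summit.QuantumFields.BalabanUV.T4Continuum.HistoryAssemblyTermsLE
open Summit.QuantumFields.BalabanUV.T4Continuum.HistoryRealise Summit.QuantumFields.BalabanUV.T4Continuum.HistoryAssemblyRealiseLE
open Summit.QuantumFields.BalabanUV.T4Continuum.HistoryAssemblyMult Summit.QuantumFields.BalabanUV.T4Continuum.HistoryAssemblyMultKey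
open Summit.QuantumFields.BalabanUV.T4Continuum.HistoryAssemblyRealiseRun Summit.QuantumFields.BalabanUV.T4Continuum.HistoryAssemblyRealiseMult
open Summit.QuantumFields.BalabanUV.T4Continuum.HistoryZones Summit.QuantumFields.BalabanUV.T4Continuum.HistoryRealiseCells
open Summit.QuantumFields.BalabanUV.T4Continuum.HistoryRealiseCellsRun Summit.QuantumFields.BalabanUV.T4Continuum.HistoryAssemblyRealiseRunMult
open Summit.QuantumFields.BalabanUV.T4Continuum.HistoryRealiseCellsRunMult Summit.QuantumFields.BalabanUV.T4Continuum.HistoryAssemblyMultInstance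
open Summit.QuantumFields.BalabanUV.T4Continuum.HistoryJoinsPlacedMember Summit.QuantumFields.BalabanUV.T4Continuum.PlacementSkeleton
open Summit.QuantumFields.BalabanUV.T4Continuum.HistoryJoinsPlacedMult Summit.QuantumFields.BalabanUV.T4Continuum.HistoryRealiseDistinct
open Summit.QuantumFields.BalabanUV.T4Continuum.HistoryRegionTemplates Summit.QuantumFields.BalabanUV.T4Continuum.HistoryCaps
open Summit.QuantumFields.BalabanUV.T4Continuum.HistoryZoneEvolve (cth)
open Literature.MathematicalPhysics.QuantumFieldTheory.Balaban1983to89.B16SProfile (DropCtl)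
open Summit.QuantumFields.BalabanUV.T4Continuum.HistoryRealiseCellsRunMultEnd Summit.QuantumFields.BalabanUV.T4Continuum.HistoryRealiseCellsRunMultEndD
open Summit.QuantumFields.BalabanUV.T4Continuum.HistoryRealiseCellsRunPinnedT3b Summit.QuantumFields.BalabanUV.T4Continuum.HistoryHybridRescale
open Summit.QuantumFields.BalabanUV.T4Continuum.HistoryRealiseCellsRunApex (exists_const_schemeZ)
open Summit.QuantumFields.BalabanUV.T4Continuum.HistoryRealisePrint Summit.QuantumFields.BalabanUV.T4Continuum.HistoryRealiseWeak
open Summit.QuantumFields.BalabanUV.T4Continuum.HistoryRealisePrintReading Summit.QuantumFields.BalabanUV.T4Continuum.HistoryRealiseWeakReading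
open Summit.QuantumFields.BalabanUV.T4Continuum.HistoryRealisePrintCells Summit.QuantumFields.BalabanUV.T4Continuum.HistoryRealiseWeakCells
open Summit.QuantumFields.BalabanUV.T4Continuum.HistoryRealiseCellsRunApexT3b Summit.QuantumFields.BalabanUV.T4Continuum.HistoryRealiseCellsRunApexT3bW

open Summit.QuantumFields.BalabanUV.T4Continuum.HistoryRealiseCellsRunApexT3bWT Summit.QuantumFields.BalabanUV.T4Continuum.HistoryRealiseCellsRunPinnedT3bWT
open Summit.QuantumFields.BalabanUV.T4Continuum.HistoryRealiseCellsRunHeadlineT3bWT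
open Summit.QuantumFields.BalabanUV.T4Continuum.HistoryRealiseCellsRunApexT3bWTV Summit.QuantumFields.BalabanUV.T4Continuum.HistoryBankingVolumePlug
open Summit.QuantumFields.BalabanUV.T4Continuum.HistoryRealiseCellsRunApexT3bWTVS

namespace Summit.QuantumFields.BalabanUV.T4Continuum.HistoryRealiseCellsRunHeadlineT3bWTVS

noncomputable section

section Apex

variable {F : T4Family} {G : Type*} [GaugeGroup G] [MeasurableSpace G] [HaarData G] [RegularGaugeGroup G]

/-! ## §1 The apex input from the weighted witness -/

/-- **ROW NE7b AT THE APEX OVER END v3′ FROM THE WEIGHTED `κ := costT` WITNESS, SPLIT SLACK**: the owner's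
`hybridNE7Under_of_countRoadT3bWTV_fsc` at `reslack O θᵥ` through `toWTV`; hypothesis `CountRoadWitnessT3bWTVS D C O θᵥ …`, slack
`C.a + (θ + θᵥ) ≤ ½γ₀A₁²`; conclusion identical.  NE7b NOT proved. [folklore] -/
theorem hybridNE7Under_of_countRoadT3bWTVS_fsc (D : FiniteEpsData F G) (hM : D.AvgMeasurable)

    (hsign : B16.SignConventions D.C)
    {C : T4PrintedShapeBanking.Consts} {O : PrintedO1s}
    {rr : ℕ} {β₀ : ℝ} (h : ThresholdOK C F.L rr β₀) (hμ : 0 < C.μ) (d n : ℕ)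
    (hκ₁ : (d : ℝ) * Real.log F.L + 2 * Real.log 2 ≤ C.κ₁) (hE₀ : Real.log (2 + birthMass C) ≤ C.E₀)
    (hA₀ : 1 ≤ C.A₀) (hβ₀ : 0 < β₀) (hLβ : (F.L : ℝ) * β₀ ≤ 1) (hn₁ : 13 ≤ C.n₁) (hn : 0 < n)
    {θ θv : ℝ} (hθ : 0 ≤ θ) (hslack : C.a + (θ + θv) ≤ O.γ₀ * O.A₁ ^ 2 / 2)
    (hE₂ : 0 < C.E₂) (hE₃ : 0 ≤ C.E₃) {sS : ℕ} (hsS : 1 ≤ sS)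
    (hsmall : (((2 * cth 32 1 sS + 1) ^ d : ℕ) : ℝ) * (5 : ℝ) ^ d * ((max 1 (2 * 32 + 2) : ℕ) : ℝ) ≤
      (F.L : ℝ) ^ (sS / 2) / 2)
    {θc : ℝ} (hθc0 : 0 ≤ θc) (hθc1 : θc < 1) (hθcs : 1 / 2 ≤ θc ^ sS)
    (hθJ : (2 +
            ((2 * (((2 * cth 32 1 sS + 1) ^ d : ℕ) : ℝ) * ((((2 * 32 + 1) ^ d : ℕ) : ℝ) * (4 * 2 ^ d)) +
                  4 * ((((2 * cth 32 1 sS + 1) ^ d : ℕ) : ℝ) * (5 : ℝ) ^ d)) / (1 - θc) +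
              2 * (2 * ((((2 * cth 32 1 sS + 1) ^ d : ℕ) : ℝ) * (5 : ℝ) ^ d))) +
            (2 * ((0 + 2 * Real.log (2 * d + 1)) + (2 * (d : ℝ) + 2 * Real.log (2 * d + 1)) *
                  (((max 1 (2 * 32 + 2) : ℕ) : ℝ) * (2 * ((((2 * cth 32 1 sS + 1) ^ d : ℕ) : ℝ) * (5 : ℝ) ^ d)))) +
              (2 * (d : ℝ) + 2 * Real.log (2 * d + 1)) * 1 *
                (((max 1 (2 * 32 + 2) : ℕ) : ℝ) *
                    ((2 * (((2 * cth 32 1 sS + 1) ^ d : ℕ) : ℝ) * ((((2 * 32 + 1) ^ d : ℕ) : ℝ) * (4 * 2 ^ d)) +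
                        4 * ((((2 * cth 32 1 sS + 1) ^ d : ℕ) : ℝ) * (5 : ℝ) ^ d)) / (1 - θc)) +
                  4 * 2 ^ d)) +
            10) + 8 * 2 ^ d * Real.log (2 * d + 1) ≤ θ)
    (hData : T4ContinuumYM4Torus.ForSmallCouplings D fun g₀ => ∀ os : List (ULoop F),
        ∃ (ι α π : Type) (_ : DecidableEq ι) (_ : DecidableEq α) (_ : DecidableEq π),
          Nonempty (CountRoadWitnessT3bWTVS D C O θv rr d n hn g₀ os ι α π)) :
    T4ApexHybrid.HybridNE7Under D (BetaPertHyp D.βfun) :=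
  hybridNE7Under_of_countRoadT3bWTV_fsc D hM hsign h hμ d n hκ₁ hE₀ hA₀ hβ₀ hLβ hn₁ hn hθ (reslack_hslack hslack) hE₂ hE₃ hsS hsmall hθc0 hθc1 hθcs hθJ
    (hData.mono fun g₀ hg os => by
      obtain ⟨ι, α, π, i₁, i₂, i₃, ⟨X⟩⟩ := hg os
      exact ⟨ι, α, π, i₁, i₂, i₃, ⟨X.toWTV⟩⟩)

/-! ## §2 Sanity: the owner's V-witness is the weighted witness at `uV := 0` -/

omit [GaugeGroup G] [MeasurableSpace G] [HaarData G] [RegularGaugeGroup G] in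
/-- at the zero weight family the weighted class factor is `1` [folklore] -/
theorem exp_birthWT_zero {α π : Type} [DecidableEq α] [DecidableEq π] (G' : Gen (Lab α π)) :
    Real.exp (birthWT Prod.fst (fun _ => (0 : ℝ)) G') = 1 := by
  have : birthWT Prod.fst (fun _ => (0 : ℝ)) G' = 0 := Finset.sum_eq_zero fun _ _ => by simp
  rw [this, Real.exp_zero]

omit [RegularGaugeGroup G] in
/-- **THE OWNER's `κ := costT` WITNESS IS A WEIGHTED WITNESS WITH `uV := 0`** (any `θᵥ ≥ 0`): so the V-headline
`continuumYM4Torus_of_countRoadT3bWTV_fsc` is, by name, the case `θᵥ := 0` of `continuumYM4Torus_of_countRoadT3bWTVS_fsc`. [folklore] -/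
def ofWTV {D : FiniteEpsData F G} {C : T4PrintedShapeBanking.Consts} {O : PrintedO1s} {θv : ℝ} (hθv : 0 ≤ θv)
    {rr d n : ℕ} {hn : 0 < n} {g₀ : ℕ → ℝ} {os : List (ULoop F)} {ι α π : Type} [DecidableEq ι] [DecidableEq α]
    [DecidableEq π] (X : CountRoadWitnessT3bWTV D C O rr d n hn g₀ os ι α π) :
    CountRoadWitnessT3bWTVS D C O θv rr d n hn g₀ os ι α π :=
  { X with
    uV := fun _ _ => 0
    huV := fun _ _ _ _ _ _ _ _ _ => mul_nonneg hθv (sq_nonneg _)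
    priceM := fun K t ht hK τ hτ =>
      (X.priceM K t ht hK τ hτ).trans (le_of_eq (Finset.prod_congr rfl fun q _ => by
        rw [exp_birthWT_zero q.2, mul_one]))
    priceM' := fun K t ht hK τ hτ =>
      (X.priceM' K t ht hK τ hτ).trans (le_of_eq (Finset.prod_congr rfl fun q _ => by
        rw [exp_birthWT_zero q.2, mul_one])) }

end Apex

section SU

variable {F : T4Family} {N : ℕ} [NeZero N] {ℰ : LoopAverage (Matrix.specialUnitaryGroup (Fin N) ℂ)}

/-! ## §3 The headline predicate from the weighted witness -/

/-- **THE HEADLINE PREDICATE FROM THE COUNT ROAD OVER END v3′, WEIGHTED `κ := costT` WITNESS, SPLIT SLACK**: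
`T4ContinuumYM4Torus.ContinuumYM4Torus D` for (0.4)-block-averaged data on `SU(N)` with a measurable small-loop average, GIVEN the
two pins `(B)` and `BetaPertHyp` BY NAME, the datum's sign conventions, END v3′'s constants-only side conditions with the slack
`C.a + (θ + θᵥ) ≤ ½γ₀A₁²`, and a `CountRoadWitnessT3bWTVS D C O θᵥ …` for all small-coupling tuned runs and every loop string — the
owner's V-headline at `reslack O θᵥ` through `toWTV`.  The witness displays the volume's class remainder as the weight family
`uV` under D-V1 instead of reading it.  NE7b NOT proved; count 0∕9. [folklore] -/
theorem continuumYM4Torus_of_countRoadT3bWTVS_fsc (D : FiniteEpsData F (Matrix.specialUnitaryGroup (Fin N) ℂ))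

    (hBA : D.IsBlockAveraged ℰ) (hE : ℰ.MeasurableE)
    (hB : B16.EndStatementBPrinted D.C) (hβ : BetaPertHyp D.βfun) (hsign : B16.SignConventions D.C)
    {C : T4PrintedShapeBanking.Consts} {O : PrintedO1s}
    {rr : ℕ} {β₀ : ℝ} (h : ThresholdOK C F.L rr β₀) (hμ : 0 < C.μ) (d n : ℕ)
    (hκ₁ : (d : ℝ) * Real.log F.L + 2 * Real.log 2 ≤ C.κ₁) (hE₀ : Real.log (2 + birthMass C) ≤ C.E₀)
    (hA₀ : 1 ≤ C.A₀) (hβ₀ : 0 < β₀) (hLβ : (F.L : ℝ) * β₀ ≤ 1) (hn₁ : 13 ≤ C.n₁) (hn : 0 < n)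
    {θ θv : ℝ} (hθ : 0 ≤ θ) (hslack : C.a + (θ + θv) ≤ O.γ₀ * O.A₁ ^ 2 / 2)
    (hE₂ : 0 < C.E₂) (hE₃ : 0 ≤ C.E₃) {sS : ℕ} (hsS : 1 ≤ sS)
    (hsmall : (((2 * cth 32 1 sS + 1) ^ d : ℕ) : ℝ) * (5 : ℝ) ^ d * ((max 1 (2 * 32 + 2) : ℕ) : ℝ) ≤
      (F.L : ℝ) ^ (sS / 2) / 2)
    {θc : ℝ} (hθc0 : 0 ≤ θc) (hθc1 : θc < 1) (hθcs : 1 / 2 ≤ θc ^ sS)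
    (hθJ : (2 +
            ((2 * (((2 * cth 32 1 sS + 1) ^ d : ℕ) : ℝ) * ((((2 * 32 + 1) ^ d : ℕ) : ℝ) * (4 * 2 ^ d)) +
                  4 * ((((2 * cth 32 1 sS + 1) ^ d : ℕ) : ℝ) * (5 : ℝ) ^ d)) / (1 - θc) +
              2 * (2 * ((((2 * cth 32 1 sS + 1) ^ d : ℕ) : ℝ) * (5 : ℝ) ^ d))) +
            (2 * ((0 + 2 * Real.log (2 * d + 1)) + (2 * (d : ℝ) + 2 * Real.log (2 * d + 1)) *
                  (((max 1 (2 * 32 + 2) : ℕ) : ℝ) * (2 * ((((2 * cth 32 1 sS + 1) ^ d : ℕ) : ℝ) * (5 : ℝ) ^ d)))) +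
              (2 * (d : ℝ) + 2 * Real.log (2 * d + 1)) * 1 *
                (((max 1 (2 * 32 + 2) : ℕ) : ℝ) *
                    ((2 * (((2 * cth 32 1 sS + 1) ^ d : ℕ) : ℝ) * ((((2 * 32 + 1) ^ d : ℕ) : ℝ) * (4 * 2 ^ d)) +
                        4 * ((((2 * cth 32 1 sS + 1) ^ d : ℕ) : ℝ) * (5 : ℝ) ^ d)) / (1 - θc)) +
                  4 * 2 ^ d)) +
            10) + 8 * 2 ^ d * Real.log (2 * d + 1) ≤ θ)
    (hData : T4ContinuumYM4Torus.ForSmallCouplings D fun g₀ => ∀ os : List (ULoop F),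
        ∃ (ι α π : Type) (_ : DecidableEq ι) (_ : DecidableEq α) (_ : DecidableEq π),
          Nonempty (CountRoadWitnessT3bWTVS D C O θv rr d n hn g₀ os ι α π)) :
    T4ContinuumYM4Torus.ContinuumYM4Torus D :=
  continuumYM4Torus_of_countRoadT3bWTV_fsc D hBA hE hB hβ hsign h hμ d n hκ₁ hE₀ hA₀ hβ₀ hLβ hn₁ hn hθ (reslack_hslack hslack) hE₂ hE₃ hsS hsmall hθc0 hθc1 hθcs hθJ
    (hData.mono fun g₀ hg os => by
      obtain ⟨ι, α, π, i₁, i₂, i₃, ⟨X⟩⟩ := hg os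
      exact ⟨ι, α, π, i₁, i₂, i₃, ⟨X.toWTV⟩⟩)

end SU

end

end Summit.QuantumFields.BalabanUV.T4Continuum.HistoryRealiseCellsRunHeadlineT3bWTVS
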